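import Summits.QuantumFields.BalabanUV.Beta.WilsonReflectionFrame

/-!
# Transport of the colourless Wilson stencil along lattice homomorphisms injective on a finite window

HONEST FRAMING.  Discharging `BetaPertH` makes Balaban's ultraviolet stability UNCONDITIONAL — a real constructive-QFT
result; it is NOT the continuum limit and NOT the Clay problem.  This leaf is bookkeeping (cell pub-balaban, β sub-cell, lane
an3; demand X-an2-45 §3 (ii) ∕ (R45-4)): finite algebra, no estimate, no limit, nothing cited — every statement is kernel-proved
here ([folklore] = standard finite algebra, no published theorem is being quoted).

PURPOSE.  The reflection law with contact of the antisymmetrised Wilson stencil (`WilsonStencilReflection.S₀A_reflect`) is a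
statement on FINITE abelian lattices (it is proved through quadratic forms, which need finite sums), while an2's tables
`StepJetData.wEntry ∕ wilsonA` live on `ℤ^(d+1)`.  The transfer goes through a large discrete torus `(ZMod M)^(d+1)`; this file
supplies the three generic ingredients:

* §1 NATURALITY OF THE STENCIL TABLES: every row ∕ column offset of `PlaquetteStencilData.wα ∕ wβ` is an explicit `ℤ`-combination
  of frame vectors, hence commutes with additive maps: `wα (f ∘ e) γ i = f (wα e γ i)` (`wα_map`, `wβ_map`).
* §2 TRANSPORT UNDER A MAP INJECTIVE ON A WINDOW: if the additive map `f` is injective on a set `S` containing the legs and the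
  stencil's support sites, then `wilsonStencil₀ (f ∘ e) (f z) γ (f x, a) (f y, b) = wilsonStencil₀ e z γ (x, a) (y, b)`
  (`wilsonStencil₀_map`), and likewise for `WilsonReflectionFrame.S₀A` (`S₀A_map`), the contact functional
  `WilsonReflectionFrame.Lc` (`Lc_map`) and bond indicators (`prod_eq_iff_of_injOn`).
* §3 THE REDUCTION MAP `castVec M : ℤ^n →+ (ZMod M)^n` and its injectivity on the range of any FINITE family of sites once
  `M` exceeds every coordinate difference (`castVec_injOn`).
-/

namespace Summit.QuantumFields.BalabanUV.Beta.WilsonStencilTransport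

open Finset
open scoped BigOperators
open Literature.MathematicalPhysics.QuantumFieldTheory.Balaban1983to89.Beta
open PlaquetteVertex (lcurl bondLetter)
open PlaquetteStencilData (WilsonIdx RemIdx wα wβ rmα rmβ bsα bsβ boff bd₁ bd₂ diα diβ trα trβ faα faβ dvβ stencilIns_apply)
open GhostTable (curα curβ)
open SpinTable (spα)
open WilsonVertexKron (wilsonStencil₀)
open Summit.QuantumFields.BalabanUV.Beta.WilsonReflectionFrame (Lc S₀A)

/-! ## §1 Naturality of the stencil offset tables under additive maps -/

section Naturality

variable {Λ Λ' : Type*} [AddCommGroup Λ] [AddCommGroup Λ'] {D : Type*}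

/-- naturality of the current row offsets. [folklore] -/
theorem curα_map (f : Λ →+ Λ') (v : Λ) (b : Bool) : curα (f v) b = f (curα v b) := by
  cases b <;> simp [curα]

/-- naturality of the current column offsets. [folklore] -/
theorem curβ_map (f : Λ →+ Λ') (v : Λ) (b : Bool) : curβ (f v) b = f (curβ v b) := by
  cases b <;> simp [curβ]

/-- naturality of the spin offsets. [folklore] -/
theorem spα_map (f : Λ →+ Λ') (e : D → Λ) (s : D × Bool) : spα (⇑f ∘ e) s = f (spα e s) := by
  rcases s with ⟨μ, b⟩; cases b <;> simp [spα]

/-- naturality of the longitudinal column offsets. [folklore] -/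
theorem dvβ_map (f : Λ →+ Λ') (e : D → Λ) (γ : D) (p : D × Bool) : dvβ (⇑f ∘ e) γ p = f (dvβ e γ p) := by
  rcases p with ⟨μ, b⟩; cases b <;> simp [dvβ]

/-- naturality of the far-corner row offsets. [folklore] -/
theorem faα_map (f : Λ →+ Λ') (e : D → Λ) (α β : D) (b : Bool) : faα (⇑f ∘ e) α β b = f (faα e α β b) := by
  cases b <;> simp [faα]

/-- naturality of the far-corner column offsets. [folklore] -/
theorem faβ_map (f : Λ →+ Λ') (e : D → Λ) (α β : D) (b : Bool) : faβ (⇑f ∘ e) α β b = f (faβ e α β b) := by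
  cases b <;> simp [faβ]

/-- naturality of the transport row offsets. [folklore] -/
theorem trα_map (f : Λ →+ Λ') (e : D → Λ) (α β : D) (k : Fin 8) : trα (⇑f ∘ e) α β k = f (trα e α β k) := by
  fin_cases k <;> simp [trα]

/-- naturality of the transport column offsets. [folklore] -/
theorem trβ_map (f : Λ →+ Λ') (e : D → Λ) (α β : D) (k : Fin 8) : trβ (⇑f ∘ e) α β k = f (trβ e α β k) := by
  fin_cases k <;> simp [trβ]

/-- naturality of the spin-difference row offsets. [folklore] -/
theorem diα_map (f : Λ →+ Λ') (e : D → Λ) (α β : D) (k : Fin 12) : diα (⇑f ∘ e) α β k = f (diα e α β k) := by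
  fin_cases k <;> simp [diα]

/-- naturality of the spin-difference column offsets. [folklore] -/
theorem diβ_map (f : Λ →+ Λ') (e : D → Λ) (α β : D) (k : Fin 12) : diβ (⇑f ∘ e) α β k = f (diβ e α β k) := by
  fin_cases k <;> simp [diβ]

/-- naturality of the bond base offsets. [folklore] -/
theorem boff_map (f : Λ →+ Λ') (e : D → Λ) (μ : D) (k : Fin 4) : boff (⇑f ∘ e) μ k = f (boff e μ k) := by
  fin_cases k <;> simp [boff]

/-- naturality of the one-bond-sum row offsets of a natural family. [folklore] -/
theorem bsα_map {σ : Type*} (f : Λ →+ Λ') (e : D → Λ) (γ : D) (kα : D → D → σ → Λ) (kα' : D → D → σ → Λ')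
    (hk : ∀ α β s, kα' α β s = f (kα α β s)) (p : D × (Fin 4 × σ)) :
    bsα (⇑f ∘ e) γ kα' p = f (bsα e γ kα p) := by
  simp only [bsα, boff_map, hk, map_add]

/-- naturality of the one-bond-sum column offsets of a natural family. [folklore] -/
theorem bsβ_map {σ : Type*} (f : Λ →+ Λ') (e : D → Λ) (γ : D) (kβ : D → D → σ → Λ) (kβ' : D → D → σ → Λ')
    (hk : ∀ α β s, kβ' α β s = f (kβ α β s)) (p : D × (Fin 4 × σ)) :
    bsβ (⇑f ∘ e) γ kβ' p = f (bsβ e γ kβ p) := by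
  simp only [bsβ, boff_map, hk, map_add]

/-- naturality of the remainder row offsets. [folklore] -/
theorem rmα_map (f : Λ →+ Λ') (e : D → Λ) (γ : D) (i : RemIdx D) : rmα (⇑f ∘ e) γ i = f (rmα e γ i) := by
  rcases i with (p | p) | p
  · exact bsα_map f e γ (diα e) (diα (⇑f ∘ e)) (diα_map f e) p
  · exact bsα_map f e γ (trα e) (trα (⇑f ∘ e)) (trα_map f e) p
  · exact bsα_map f e γ (faα e) (faα (⇑f ∘ e)) (faα_map f e) p

/-- naturality of the remainder column offsets. [folklore] -/
theorem rmβ_map (f : Λ →+ Λ') (e : D → Λ) (γ : D) (i : RemIdx D) : rmβ (⇑f ∘ e) γ i = f (rmβ e γ i) := by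
  rcases i with (p | p) | p
  · exact bsβ_map f e γ (diβ e) (diβ (⇑f ∘ e)) (diβ_map f e) p
  · exact bsβ_map f e γ (trβ e) (trβ (⇑f ∘ e)) (trβ_map f e) p
  · exact bsβ_map f e γ (faβ e) (faβ (⇑f ∘ e)) (faβ_map f e) p

/-- **NATURALITY OF THE WILSON ROW OFFSETS**: `wα (f ∘ e) γ i = f (wα e γ i)` for every additive `f`. [folklore] -/
theorem wα_map (f : Λ →+ Λ') (e : D → Λ) (γ : D) (i : WilsonIdx D) : wα (⇑f ∘ e) γ i = f (wα e γ i) := by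
  rcases i with ((b | s) | p) | r
  · exact curα_map f (e γ) b
  · exact spα_map f e s
  · exact (map_zero f).symm
  · exact rmα_map f e γ r

/-- **NATURALITY OF THE WILSON COLUMN OFFSETS**: `wβ (f ∘ e) γ i = f (wβ e γ i)`. [folklore] -/
theorem wβ_map (f : Λ →+ Λ') (e : D → Λ) (γ : D) (i : WilsonIdx D) : wβ (⇑f ∘ e) γ i = f (wβ e γ i) := by
  rcases i with ((b | s) | p) | r
  · exact curβ_map f (e γ) b
  · exact spα_map f e s
  · exact dvβ_map f e γ p
  · exact rmβ_map f e γ r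

end Naturality

/-! ## §2 Transport of the colourless stencil, of `S₀A`, of `Lc` and of bond indicators -/

section Transport

variable {Λ Λ' : Type*} [DecidableEq Λ] [AddCommGroup Λ] [DecidableEq Λ'] [AddCommGroup Λ'] {D : Type*} [Fintype D]
  [DecidableEq D]

/-- **TRANSPORT OF THE COLOURLESS WILSON STENCIL**: an additive `f` injective on a set containing the two legs and every support
site `z + wα e γ i`, `z + wβ e γ i` does not change the entries. [folklore] -/
theorem wilsonStencil₀_map (f : Λ →+ Λ') {S : Set Λ} (hS : Set.InjOn f S) (e : D → Λ) (z : Λ) (γ : D) {x y : Λ}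
    (hx : x ∈ S) (hy : y ∈ S) (hα : ∀ i, z + wα e γ i ∈ S) (hβ : ∀ i, z + wβ e γ i ∈ S) (a b : D) :
    wilsonStencil₀ (⇑f ∘ e) (f z) γ (f x, a) (f y, b) = wilsonStencil₀ e z γ (x, a) (y, b) := by
  simp only [wilsonStencil₀, stencilIns_apply, wα_map, wβ_map, ← map_add]
  refine Finset.sum_congr rfl fun i _ => ?_
  simp only [hS.eq_iff hx (hα i), hS.eq_iff hy (hβ i)]

/-- **TRANSPORT OF `S₀A`** (the antisymmetrised colourless stencil). [folklore] -/
theorem S₀A_map (f : Λ →+ Λ') {S : Set Λ} (hS : Set.InjOn f S) (e : D → Λ) (z : Λ) (γ : D) {x y : Λ}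
    (hx : x ∈ S) (hy : y ∈ S) (hα : ∀ i, z + wα e γ i ∈ S) (hβ : ∀ i, z + wβ e γ i ∈ S) (a b : D) :
    S₀A (⇑f ∘ e) (f z) γ (f x, a) (f y, b) = S₀A e z γ (x, a) (y, b) := by
  unfold S₀A
  rw [wilsonStencil₀_map f hS e z γ hx hy hα hβ, wilsonStencil₀_map f hS e z γ hy hx hα hβ]

/-- **TRANSPORT OF THE CONTACT FUNCTIONAL `Lc`**: `f` injective on a set containing the source site `x`, the test site `u` and
the sites `u − e ν`, `u + e μ`, `u − e ν + e μ`. [folklore] -/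
theorem Lc_map (f : Λ →+ Λ') {S : Set Λ} (hS : Set.InjOn f S) (e : D → Λ) (α : D) (u x : Λ) (a : D) (hx : x ∈ S)
    (hu : u ∈ S) (h₁ : ∀ ν, u - e ν ∈ S) (h₂ : ∀ μ, u + e μ ∈ S) (h₃ : ∀ ν μ, u - e ν + e μ ∈ S) :
    Lc (⇑f ∘ e) α (f u) (f x, a) = Lc e α u (x, a) := by
  have e₀ : f u = f x ↔ u = x := hS.eq_iff hu hx
  have e₁ : ∀ ν, f (u - e ν) = f x ↔ u - e ν = x := fun ν => hS.eq_iff (h₁ ν) hx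
  have e₂ : ∀ μ, f (u + e μ) = f x ↔ u + e μ = x := fun μ => hS.eq_iff (h₂ μ) hx
  have e₃ : ∀ ν μ, f (u - e ν + e μ) = f x ↔ u - e ν + e μ = x := fun ν μ => hS.eq_iff (h₃ ν μ) hx
  unfold Lc lcurl bondLetter
  simp only [Function.comp_apply, ← map_sub, ← map_add, e₀, e₁, e₂, e₃]

omit [AddCommGroup Λ] [AddCommGroup Λ'] [Fintype D] [DecidableEq D] [DecidableEq Λ] [DecidableEq Λ'] in
/-- transport of a bond indicator. [folklore] -/
theorem prod_eq_iff_of_injOn (f : Λ → Λ') {S : Set Λ} (hS : Set.InjOn f S) {u z : Λ} (hu : u ∈ S) (hz : z ∈ S)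
    (α b : D) : ((f u, α) = (f z, b)) ↔ ((u, α) = (z, b)) := by
  simp only [Prod.mk.injEq, hS.eq_iff hu hz]

end Transport

/-! ## §3 Reduction modulo `M` and its injectivity on finite windows -/

section Cast

variable {n : ℕ}

/-- COORDINATEWISE REDUCTION `ℤ^n → (ZMod M)^n` as an additive homomorphism.  A definition asserting nothing. [folklore] -/
def castVec (M : ℕ) : (Fin n → ℤ) →+ (Fin n → ZMod M) where
  toFun x := fun i => (x i : ZMod M)
  map_zero' := by funext i; simp
  map_add' x y := by funext i; simp

/-- coordinates of the reduction. [folklore] -/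
@[simp] theorem castVec_apply (M : ℕ) (x : Fin n → ℤ) (i : Fin n) : castVec M x i = (x i : ZMod M) := rfl

/-- **INJECTIVITY ON A FINITE WINDOW**: for a finite family of sites `pts`, reduction modulo
`M = 1 + Σ_{i,i′,j} |pts i j − pts i′ j|` is injective on the range of the family. [folklore] -/
theorem castVec_injOn {ι : Type*} [Fintype ι] (pts : ι → Fin n → ℤ) :
    Set.InjOn (castVec (∑ i, ∑ i', ∑ j, (pts i j - pts i' j).natAbs + 1)) (Set.range pts) := by
  rintro _ ⟨i, rfl⟩ _ ⟨i', rfl⟩ h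
  funext j
  have hj : ((pts i j : ℤ) : ZMod (∑ i, ∑ i', ∑ j, (pts i j - pts i' j).natAbs + 1)) = (pts i' j : ℤ) := by
    simpa using congr_fun h j
  have hdvd := (ZMod.intCast_eq_intCast_iff_dvd_sub _ _ _).1 hj
  have hle : (pts i' j - pts i j).natAbs ≤ ∑ i, ∑ i', ∑ j, (pts i j - pts i' j).natAbs :=
    calc (pts i' j - pts i j).natAbs
        ≤ ∑ j', (pts i' j' - pts i j').natAbs :=
          Finset.single_le_sum (f := fun j' => (pts i' j' - pts i j').natAbs) (fun _ _ => Nat.zero_le _) (mem_univ j)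
      _ ≤ ∑ i'', ∑ j', (pts i' j' - pts i'' j').natAbs :=
          Finset.single_le_sum (f := fun i'' => ∑ j', (pts i' j' - pts i'' j').natAbs) (fun _ _ => Nat.zero_le _)
            (mem_univ i)
      _ ≤ ∑ i₀, ∑ i'', ∑ j', (pts i₀ j' - pts i'' j').natAbs :=
          Finset.single_le_sum (f := fun i₀ => ∑ i'', ∑ j', (pts i₀ j' - pts i'' j').natAbs) (fun _ _ => Nat.zero_le _)
            (mem_univ i')
  have hlt : |pts i' j - pts i j| < ((∑ i, ∑ i', ∑ j, (pts i j - pts i' j).natAbs + 1 : ℕ) : ℤ) := by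
    rw [Int.abs_eq_natAbs]; exact_mod_cast Nat.lt_succ_of_le hle
  have h0 := Int.eq_zero_of_abs_lt_dvd hdvd hlt
  linarith

end Cast

end Summit.QuantumFields.BalabanUV.Beta.WilsonStencilTransport
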